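import Summits.QuantumFields.BalabanUV.T4Continuum.Support.NE2FromNE3BavgBridge

/-!
# SUBSTRATE — W-26 = L-E20 «THE WINDOWED LOCAL RATE»: `LocalRateOn S` = node U1b's `LocalRate` clause restricted to a set `S` of levels, its
# restriction ∕ monotonicity ∕ `univ` ∕ window laws, and the WINDOWED TWIN of row NE2's bridge `NE2FromNE3BavgBridge.localRate_regClass_of_bavg_consistent`
# (typer (π5-3) l.23503, (π7-2) l.23619, typed targets (π8-1) l.23727; t4-dagwriter Q50 l.23527; repair road (R1) of F-TOP = GAPS § G-subp3g4-1)

Cell `pub-balaban`, SUBSTRATE cell, seat `b2b-balaban-substrate-p3` (gen 4).  Summits-side under the LEAN PLACEMENT RULE (a Summit-side RESTRICTION of a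
Literature clause — `T4EtaRateMin.LocalRate` is NOT touched; [folklore] bookkeeping; nothing printed asserted; no citation tags).  The substrate OFFERS the
notion; it does not legislate row NE2's road (45-min hold-off to t4-ne2-p1 ∕ t4-dagwriter ∕ NE5 owner g39, journal INTENT line).
WHY (F-TOP, kernel: `SubstrateAvgTowerPlumbing` §5 ∕ certificate 17740b1b6fd41526): `LocalRate` quantifies over ALL levels; at a `towerOf`-PADDED tower its
`k = K` instance compares the finest connection with the junk level and forces the finest field within `2|o|C·L^{−2K}` of `1`; the two-level letters are
meaningful on the window `{k | k + 1 ≤ K}` (both levels carry a V1 lattice; R55∕R56 precedent).  Row NE2's bridge is LEVELWISE (`NE2FromNE3.localRate_of_consistent`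
at the same `k`; `norm_sub_bavg_parT_le` at `k` reads the Lipschitz letter at `k + 1` only), so it restricts to any window.
WHAT.  §1 **`LocalRateOn S R C θ`** (`∀ k ∈ S, …`), `localRateOn_of_localRate`, `localRateOn_empty`, `LocalRateOn.anti` (in `S`),
**`localRateOn_univ_iff`**, `LocalRateOn.mono` (constants), **`levelWindow K := {k | k + 1 ≤ K}`** (`mem_levelWindow_iff`, `lt_of_mem_levelWindow`,
`levelWindow_mono`), **`localRateOn_levelWindow_iff`**, `localRateOn_of_residual`.  §2 **`localRateOn_of_consistentOn`** (consistency `β∕lev L k` on `S` ⟹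
`LocalRateOn S (bgReadings L M 𝒟) β L⁻¹`; NE2's edge lemma level by level).  §3 **`consistentOn_of_bavg_consistentOn`**,
**`localRateOn_of_bavg_consistentOn`** (typed target `TwinTargetA`), **`localRateOn_regClass_of_bavg_consistentOn`** (typed target `TwinTargetB`: (ℓ1)(ℓ2) un-windowed,
(ℓ3)(ℓ4) ON `S` ⟹ `LocalRateOn S (bgReadings L M (regClass L M R)) (γ + 2d·max β βD) L⁻¹`, SAME constant as NE2), `localRateOn_regClass_of_bavg_consistent` (sanity:
the un-windowed letters give it on every `S`).  NOT HERE (ON REQUEST): the converse `LocalRateOn ⟹` windowed block-average consistency.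
HONEST FRAMING: rung (B)+1 of the FINITE-VOLUME T⁴ programme — NOT infinite volume, NOT a mass gap, NOT Clay; spine PROVED 0∕9; NE5 ∕ NE2 NOT PRINTED ∕
NOT PROVED; substrate = data + structural lemmas + bookkeeping, NO estimate of any NE row; no row's hypothesis is weakened from outside (the owner twins
g38-c′ ∕ W-21c′ are ON EVENT, others').  HONEST DEPENDENCY (cell line, verbatim): continuum YM on T⁴ ⇐ BetaPertH ∧ nine spine estimates (0/9 proved);
BetaPertH ⇐ (D1) ∧ (D4) ∧ CAP+tail; G-an2-4 gates asym, D1 and NE2/3/4.  0 sorry; axioms ⊆ {propext, Classical.choice, Quot.sound}.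
-/

noncomputable section

open scoped BigOperators Matrix Matrix.Norms.L2Operator

namespace Summit.QuantumFields.BalabanUV.T4Continuum.SubstrateLocalRateOn

open Literature.MathematicalPhysics.QuantumFieldTheory.Balaban1983to89.B5Prop11Plancherel (fine Tor)
open Literature.MathematicalPhysics.QuantumFieldTheory.Balaban1983to89.B5G183RateUnitTower (lev lev_neZero)
open Literature.MathematicalPhysics.QuantumFieldTheory.Balaban1983to89.T4EtaRateMin (Readings LocalRate)
open Summit.QuantumFields.BalabanUV.T4Continuum
open Summit.QuantumFields.BalabanUV.T4Continuum.BalabanAveragedTowerModes (par)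
open Summit.QuantumFields.BalabanUV.T4Continuum.BalabanAveragedTowerUnit (idx cast_lev' norm_entry_le_opNorm)
open Summit.QuantumFields.BalabanUV.T4Continuum.BlockPairingGeometry (tau parT)
open Summit.QuantumFields.BalabanUV.T4Continuum.CovariantLinePlanting (bavg)
open Summit.QuantumFields.BalabanUV.T4Continuum.NE2FromNE3 (bgReadings pt entryAt par_pt_succ)
open Summit.QuantumFields.BalabanUV.T4Continuum.NE2FromNE3BavgBridge (norm_sub_bavg_parT_le)
open Summit.QuantumFields.BalabanUV.T4Continuum.RegularBackgroundTower (RegularTransporters connTower dconnTower regClass connTower_lipschitz)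

/-! ## §1 The windowed local rate -/

section Notion

variable {ι X : Type*}

/-- HYPOTHESIS SHAPE **`LocalRateOn S`** — THE WINDOWED LOCAL RATE: node U1b's `T4EtaRateMin.LocalRate` clause (consecutive levels' local readings differ
by at most `C·θ^k`) asked only at the levels `k ∈ S` (intended `S := levelWindow K` below the top level of a padded tower, where the full-`ℕ` clause is
vacuous: F-TOP). [folklore] -/
def LocalRateOn (S : Set ℕ) (R : Readings ι X) (C θ : ℝ) : Prop :=
  ∀ k ∈ S, ∀ V ∈ R.dom, ∀ x : X, |R.loc (k + 1) V x - R.loc k V x| ≤ C * θ ^ k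

/-- [folklore] `LocalRate` restricts to every window. -/
theorem localRateOn_of_localRate {R : Readings ι X} {C θ : ℝ} (h : LocalRate R C θ) (S : Set ℕ) : LocalRateOn S R C θ :=
  fun k _ V hV x => h k V hV x

/-- [folklore] the empty window carries no content (the `K = 0` tower). -/
theorem localRateOn_empty (R : Readings ι X) (C θ : ℝ) : LocalRateOn ∅ R C θ := fun _ hk => absurd hk (Set.notMem_empty _)

/-- [folklore] the windowed rate is ANTITONE in the window. -/
theorem LocalRateOn.anti {S S' : Set ℕ} {R : Readings ι X} {C θ : ℝ} (h : LocalRateOn S' R C θ) (hS : S ⊆ S') : LocalRateOn S R C θ :=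
  fun k hk V hV x => h k (hS hk) V hV x

/-- [folklore] **ON THE FULL WINDOW THE NOTION IS `LocalRate`**. -/
theorem localRateOn_univ_iff {R : Readings ι X} {C θ : ℝ} : LocalRateOn Set.univ R C θ ↔ LocalRate R C θ :=
  ⟨fun h k V hV x => h k (Set.mem_univ k) V hV x, fun h => localRateOn_of_localRate h Set.univ⟩

/-- [folklore] monotonicity in the constants (`C ≤ C′`, `0 ≤ θ ≤ θ′`). -/
theorem LocalRateOn.mono {S : Set ℕ} {R : Readings ι X} {C C' θ θ' : ℝ} (h : LocalRateOn S R C θ) (hC : C ≤ C') (hθ : 0 ≤ θ) (hθ' : θ ≤ θ')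
    (hC' : 0 ≤ C') : LocalRateOn S R C' θ' := fun k hk V hV x =>
  (h k hk V hV x).trans ((mul_le_mul_of_nonneg_right hC (pow_nonneg hθ k)).trans (mul_le_mul_of_nonneg_left (pow_le_pow_left₀ hθ hθ' k) hC'))

/-- [folklore] **THE LEVEL WINDOW OF A `K`-LEVEL TOWER** (the window of record, F-TOP disposition (R1)): the levels `k` whose successor `k + 1` still
carries a V1 lattice. -/
abbrev levelWindow (K : ℕ) : Set ℕ := {k | k + 1 ≤ K}

/-- [folklore] membership in the level window. -/ @[simp] theorem mem_levelWindow_iff {K k : ℕ} : k ∈ levelWindow K ↔ k + 1 ≤ K := Iff.rfl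

/-- [folklore] the level window lies below the top level. -/
theorem lt_of_mem_levelWindow {K k : ℕ} (h : k ∈ levelWindow K) : k < K := by rw [mem_levelWindow_iff] at h; omega

/-- [folklore] larger towers have larger windows. -/ theorem levelWindow_mono {K K' : ℕ} (h : K ≤ K') : levelWindow K ⊆ levelWindow K' := fun _ hk => le_trans hk h

/-- [folklore] **THE LEVELWISE FORM ON THE WINDOW OF RECORD**: a bound proved for each pair `k, k + 1 ≤ K` separately IS `LocalRateOn (levelWindow K)`. -/
theorem localRateOn_levelWindow_iff {R : Readings ι X} {C θ : ℝ} {K : ℕ} :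
    LocalRateOn (levelWindow K) R C θ ↔ ∀ k : ℕ, k + 1 ≤ K → ∀ V ∈ R.dom, ∀ x : X, |R.loc (k + 1) V x - R.loc k V x| ≤ C * θ ^ k :=
  Iff.rfl

/-- [folklore] residual form on a window (twin of `T4EtaRateMin.localRate_of_residual`): a levelwise response bound times a residual of geometric size
on the window gives the windowed rate `Γ·ρ`. -/
theorem localRateOn_of_residual {S : Set ℕ} {R : Readings ι X} {Γ ρ θ : ℝ} (hΓ : 0 ≤ Γ) (res : ℕ → ι → ℝ)
    (hresp : ∀ k ∈ S, ∀ V ∈ R.dom, ∀ x : X, |R.loc (k + 1) V x - R.loc k V x| ≤ Γ * res k V)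
    (hres : ∀ k ∈ S, ∀ V ∈ R.dom, res k V ≤ ρ * θ ^ k) : LocalRateOn S R (Γ * ρ) θ := fun k hk V hV x =>
  (hresp k hk V hV x).trans ((mul_le_mul_of_nonneg_left (hres k hk V hV) hΓ).trans (le_of_eq (mul_assoc _ _ _).symm))

end Notion

/-! ## §2 The windowed edge lemma: two-level consistency on `S` ⟹ `LocalRateOn S (bgReadings 𝒟)` -/

section Edge

variable {d : ℕ} (L : ℕ) [NeZero L] (M : Fin d → ℕ) [hM : ∀ μ, NeZero (M μ)] {o : Type*} [Fintype o] [DecidableEq o]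

/-- [folklore] **THE WINDOWED EDGE LEMMA** (row NE2's `NE2FromNE3.localRate_of_consistent`, level by level): two-level consistency in operator norm with constant
`β∕L^k` at the levels `k ∈ S` gives `LocalRateOn S (bgReadings L M 𝒟) β L⁻¹`. -/
theorem localRateOn_of_consistentOn {S : Set ℕ} {𝒟 : Set ((k : ℕ) → Fin d → (idx L M k → Matrix o o ℂ))} {β : ℝ}
    (h : ∀ W ∈ 𝒟, ∀ k ∈ S, ∀ ν (x' : idx L M (k + 1)), ‖W (k + 1) ν x' - W k ν (parT (lev L k) L M x')‖ ≤ β / (lev L k : ℕ)) :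
    LocalRateOn S (bgReadings L M 𝒟) β ((L : ℝ)⁻¹) := by
  intro k hk W hW s
  have hx : parT (lev L k) L M ((pt L M s.base s.addr (k + 1), s.cpn) : idx L M (k + 1)) = ((pt L M s.base s.addr k, s.cpn) : idx L M k) := by
    show ((par (lev L k) L M (pt L M s.base s.addr (k + 1)), s.cpn) : idx L M k) = ((pt L M s.base s.addr k, s.cpn) : idx L M k)
    rw [par_pt_succ]
  have hmat := h W hW k hk s.dir ((pt L M s.base s.addr (k + 1), s.cpn) : idx L M (k + 1))
  rw [hx, cast_lev', div_eq_mul_inv, ← inv_pow] at hmat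
  have hent : ‖entryAt L M W (k + 1) s - entryAt L M W k s‖ ≤ β * ((L : ℝ)⁻¹) ^ k := by
    have e : entryAt L M W (k + 1) s - entryAt L M W k s
        = (W (k + 1) s.dir (pt L M s.base s.addr (k + 1), s.cpn) - W k s.dir (pt L M s.base s.addr k, s.cpn)) s.row s.col := by
      rw [Matrix.sub_apply]; rfl
    rw [e]; exact (norm_entry_le_opNorm _ _ _).trans hmat
  show |(if s.re then (entryAt L M W (k + 1) s).re else (entryAt L M W (k + 1) s).im)
      - (if s.re then (entryAt L M W k s).re else (entryAt L M W k s).im)| ≤ β * ((L : ℝ)⁻¹) ^ k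
  cases s.re with
  | true =>
    simp only [if_true]
    rw [← Complex.sub_re]; exact (Complex.abs_re_le_norm _).trans hent
  | false =>
    simp only [Bool.false_eq_true, if_false]
    rw [← Complex.sub_im]; exact (Complex.abs_im_le_norm _).trans hent

end Edge

/-! ## §3 The windowed bridge -/

section Bridge

variable {d : ℕ} (L : ℕ) [NeZero L] (M : Fin d → ℕ) [hM : ∀ μ, NeZero (M μ)] {o : Type*} [Fintype o] [DecidableEq o]
variable {W : (k : ℕ) → Fin d → (idx L M k → Matrix o o ℂ)}

/-- [folklore] **«BLOCK-AVERAGE READING ON `S` ⟹ PARENT-BOND READING ON `S`»**: un-windowed Lipschitz `β` (every level) and block-average consistency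
`γ∕lev L k` at the levels `k ∈ S` give `‖W (k+1) μ x′ − W k μ (parT x′)‖ ≤ (γ + 2dβ)∕lev L k` at those levels (NE2's `norm_sub_bavg_parT_le` BY NAME — it reads
the Lipschitz letter at `k + 1` only). -/
theorem consistentOn_of_bavg_consistentOn {S : Set ℕ} {β γ : ℝ} (hβ : 0 ≤ β)
    (hlip : ∀ k μ ν (i : idx L M k), ‖W k μ (tau (fine (lev L k) M) ν i) - W k μ i‖ ≤ β / (lev L k : ℕ))
    (hbavg : ∀ k ∈ S, ∀ μ (y : idx L M k), ‖bavg (lev L k) L M (W (k + 1) μ) y - W k μ y‖ ≤ γ / (lev L k : ℕ))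
    {k : ℕ} (hk : k ∈ S) (μ : Fin d) (x' : idx L M (k + 1)) :
    ‖W (k + 1) μ x' - W k μ (parT (lev L k) L M x')‖ ≤ (γ + 2 * d * β) / (lev L k : ℕ) := by
  calc ‖W (k + 1) μ x' - W k μ (parT (lev L k) L M x')‖
      ≤ ‖W (k + 1) μ x' - bavg (lev L k) L M (W (k + 1) μ) (parT (lev L k) L M x')‖
          + ‖bavg (lev L k) L M (W (k + 1) μ) (parT (lev L k) L M x') - W k μ (parT (lev L k) L M x')‖ :=
        norm_sub_le_norm_sub_add_norm_sub _ _ _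
    _ ≤ 2 * (d * β / (lev L k : ℕ)) + γ / (lev L k : ℕ) := add_le_add (norm_sub_bavg_parT_le L M hβ hlip k μ x') (hbavg k hk μ _)
    _ = (γ + 2 * d * β) / (lev L k : ℕ) := by ring

variable {𝒟 : Set ((k : ℕ) → Fin d → (idx L M k → Matrix o o ℂ))}

/-- [folklore] **WINDOWED CONSISTENCY + LIPSCHITZ ⟹ `LocalRateOn S`** (the twin of NE2's `localRate_of_bavg_consistent`). -/
theorem localRateOn_of_bavg_consistentOn {S : Set ℕ} {β γ : ℝ} (hβ : 0 ≤ β)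
    (hlip : ∀ W ∈ 𝒟, ∀ k μ ν (i : idx L M k), ‖W k μ (tau (fine (lev L k) M) ν i) - W k μ i‖ ≤ β / (lev L k : ℕ))
    (hbavg : ∀ W ∈ 𝒟, ∀ k ∈ S, ∀ μ (y : idx L M k), ‖bavg (lev L k) L M (W (k + 1) μ) y - W k μ y‖ ≤ γ / (lev L k : ℕ)) :
    LocalRateOn S (bgReadings L M 𝒟) (γ + 2 * d * β) ((L : ℝ)⁻¹) :=
  localRateOn_of_consistentOn L M fun W hW _ hk ν x' => consistentOn_of_bavg_consistentOn L M hβ (hlip W hW) (hbavg W hW) hk ν x'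

variable {R : (k : ℕ) → Fin d → (idx L M k → Matrix o o ℂ)} {α β : ℝ}

/-- [folklore] **THE WINDOWED TWIN OF ROW NE2's BRIDGE** `NE2FromNE3BavgBridge.localRate_regClass_of_bavg_consistent`: (ℓ1) `RegularTransporters L M R α β`, (ℓ2) `hlipD`
(every level), and (ℓ3) `hbavg` ∕ (ℓ4) `hbavgD` ON THE WINDOW `S` give `LocalRateOn S (bgReadings L M (regClass L M R)) (γ + 2d·max β βD) L⁻¹` — the SAME constant
as the un-windowed bridge; at `S := levelWindow K` this is the binder an owner twin g38-c′ would display (typer (π5-4); typed target `TwinTargetB` of (π8-1)). -/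
theorem localRateOn_regClass_of_bavg_consistentOn {S : Set ℕ} (h : RegularTransporters L M R α β) {βD γ : ℝ} (hβD : 0 ≤ βD)
    (hlipD : ∀ k μ ν (i : idx L M k),
      ‖dconnTower L M R k μ (tau (fine (lev L k) M) ν i) - dconnTower L M R k μ i‖ ≤ βD / (lev L k : ℕ))
    (hbavg : ∀ k ∈ S, ∀ μ (y : idx L M k), ‖bavg (lev L k) L M (connTower L M R (k + 1) μ) y - connTower L M R k μ y‖ ≤ γ / (lev L k : ℕ))
    (hbavgD : ∀ k ∈ S, ∀ μ (y : idx L M k), ‖bavg (lev L k) L M (dconnTower L M R (k + 1) μ) y - dconnTower L M R k μ y‖ ≤ γ / (lev L k : ℕ)) :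
    LocalRateOn S (bgReadings L M (regClass L M R)) (γ + 2 * d * max β βD) ((L : ℝ)⁻¹) := by
  refine localRateOn_of_bavg_consistentOn L M (hβD.trans (le_max_right β βD)) (fun W hW k μ ν i => ?_) (fun W hW k hk μ y => ?_)
  · rcases hW with rfl | rfl
    · exact (connTower_lipschitz h k μ ν i).trans (div_le_div_of_nonneg_right (le_max_left β βD) (Nat.cast_nonneg _))
    · exact (hlipD k μ ν i).trans (div_le_div_of_nonneg_right (le_max_right β βD) (Nat.cast_nonneg _))
  · rcases hW with rfl | rfl
    · exact hbavg k hk μ y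
    · exact hbavgD k hk μ y

/-- [folklore] … and the un-windowed letters give the windowed conclusion on EVERY window (sanity: the twin specialises the original). -/
theorem localRateOn_regClass_of_bavg_consistent (S : Set ℕ) (h : RegularTransporters L M R α β) {βD γ : ℝ} (hβD : 0 ≤ βD)
    (hlipD : ∀ k μ ν (i : idx L M k),
      ‖dconnTower L M R k μ (tau (fine (lev L k) M) ν i) - dconnTower L M R k μ i‖ ≤ βD / (lev L k : ℕ))
    (hbavg : ∀ k μ (y : idx L M k), ‖bavg (lev L k) L M (connTower L M R (k + 1) μ) y - connTower L M R k μ y‖ ≤ γ / (lev L k : ℕ))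
    (hbavgD : ∀ k μ (y : idx L M k), ‖bavg (lev L k) L M (dconnTower L M R (k + 1) μ) y - dconnTower L M R k μ y‖ ≤ γ / (lev L k : ℕ)) :
    LocalRateOn S (bgReadings L M (regClass L M R)) (γ + 2 * d * max β βD) ((L : ℝ)⁻¹) :=
  localRateOn_of_localRate (NE2FromNE3BavgBridge.localRate_regClass_of_bavg_consistent L M h hβD hlipD hbavg hbavgD) S

end Bridge

end Summit.QuantumFields.BalabanUV.T4Continuum.SubstrateLocalRateOn

end
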